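import Literature.Analysis.FluidPDE.KwonDecompositionMomentum
import Literature.Analysis.FluidPDE.ConvolutionCurlCalculus
import HarnessLib

/-!
# Kwon's Lemma 2.5: the force of the perturbed system is divergence free

Analysis/FluidPDE file on the discharge path of the named fact
`Literature.Analysis.FluidPDE.kwon2023_velocity_epsilon_regularity`
(`PressureFreeEpsilonRegularity.lean`; H. Kwon, J. Differential Equations (2023) =
arXiv:2104.03160, Thm. 1.4), fourteenth brick of Lemma 2.5: the `force_divFree` clause of
Def. 2.4 (`Kwon2023.IsPerturbedSuitableOn`) for Kwon's force `f(t) = f_{W(t)}`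
(`kwonSliceForce`, `forceField`). PRINTED (arXiv p. 7, Lemma 2.5): "`v` satisfies … for some
divergence-free `f`"; in the proof (pp. 8–9) `f` collects the commutator terms
`−curl W_ξ`-type expressions tested against `ξ`, the harmonic-part curl forces and `−P[F]`, all
of which are divergence free. Slot by slot:

* the transposed commutators `T'_K w` (`curlKernelTranspose`, `K = K_Δ, K_i`) annihilate
  gradients: by the transpose identity `∫ ⟪T'_K w, ∇θ⟫ = ∫ ⟪w, curl (T_K ∇θ)⟫`
  (`integral_inner_curl_kernelIntegralOp`) and `T_K ∇θ ≡ 0`, since the kernels are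
  `c(x) (∇κ(x − y) × ·)` and `∫ ∇κ(x − y) × ∇θ(y) dy = curl (κ ⋆ ∇θ)(x) = curl ∇(κ ⋆ θ)(x) = 0`
  (`curl_convolution_lsmul_gradient`);
* the curl potentials `curl((∂ᵢk) ⋆ j)` and the Leray projection `P[F]` are classically
  divergence free (`div curl = 0`, `isDivFree_classicalLerayProj`), so they annihilate gradients
  by integration by parts.

Main results: `integral_inner_kwonSliceForce_gradient_eq_zero` (one slice, any test function
`θ ∈ C_c^∞(ℝ³)`) and `divFree_forceField` — the `force_divFree` clause
`∫∫_O ⟪f, ∇θ⟫ = 0` on any open `O` on which `f` is locally integrable (Fubini). No NS-regularity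
statement is touched.

## Mathlib / tree search

Tree (reused): `kwonSliceForce`, `integrable_coord_smul` (`KwonSliceMomentum`); `forceField`
(`KwonSpaceTimeFields`); `kernelIntegralOp`, `curlKernelTranspose`,
`integral_inner_curl_kernelIntegralOp`, `continuous_curlKernelTranspose` (`KwonKernelOperators`);
`commKernelDir`, `commKernelLap`, `annularKernelDeriv`, `contDiff_uncurry_commKernelDir/Lap`,
`hasCompactSupport_uncurry_commKernelDir/Lap` (`KwonCommutatorFields`);
`curl_convolution_lsmul_eq_integral_cross_of_locallyIntegrable`, `continuous_cross_of`
(`KwonLocalLerayDuality`); `curl_convolution_lsmul_gradient` (`ConvolutionCurlCalculus`);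
`selfStretch`, `contDiff_selfStretch`, `hasCompactSupport_selfStretch`
(`KwonConvectiveTransposes`); `isDivFree_classicalLerayProj`, `contDiff_classicalLerayProj`
(`ClassicalLerayProjection`); `divergence_curl_eq_zero_holds`, `contDiff_curl`;
`integral_mul_divergence_add_eq_zero_left` (`WholeSpaceIBP`); `integrable_inner_of_locallyIntegrableOn`,
`IsSpaceTimeTestOn.continuous_gradient_field` (`SuitableWeakPressure`).

## References

* H. Kwon, J. Differential Equations (2023) = arXiv:2104.03160: Lemma 2.5 (p. 7) and its proof
  (pp. 8–9), Def. 2.4. [Kwon2023RolePressure]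
-/

noncomputable section

open MeasureTheory Set Function Filter Topology TopologicalSpace Metric InnerProductSpace
  ContinuousLinearMap
open scoped NNReal ENNReal RealInnerProductSpace Convolution Laplacian ContDiff

namespace Literature.Analysis.FluidPDE

namespace Kwon2023

variable {U : EuclideanSpace ℝ (Fin 3) → EuclideanSpace ℝ (Fin 3)}
  {θ : EuclideanSpace ℝ (Fin 3) → ℝ}

/-! ### The commutator kernels annihilate gradients -/

/-- `∫ ∇κ(x − y) × ∇θ(y) dy = curl (κ ⋆ ∇θ)(x) = 0` for a smooth compactly supported kernel `κ`
and `θ ∈ C¹_c`. [folklore] -/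
private theorem integral_cross_gradient_gradient_eq_zero {κ : EuclideanSpace ℝ (Fin 3) → ℝ}
    (hκ : ContDiff ℝ ∞ κ) (hκc : HasCompactSupport κ) (hθ : ContDiff ℝ 1 θ)
    (x : EuclideanSpace ℝ (Fin 3)) :
    ∫ y, cross (gradient κ (x - y)) (gradient θ y) = 0 := by
  rw [← curl_convolution_lsmul_eq_integral_cross_of_locallyIntegrable (contDiff_infty.1 hκ 1) hκc
    (FluidPDE.continuous_gradient_of_contDiff hθ).locallyIntegrable x]
  exact curl_convolution_lsmul_gradient hκ hκc hθ x

/-- **`T_{K_a} ∇θ = 0`**: the kernel operator of the `∂ₐ`-commutator kills gradients.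
[cite: Kwon2023RolePressure, Lemma 2.5 (proof, p. 8)] -/
theorem kernelIntegralOp_commKernelDir_gradient (a : EuclideanSpace ℝ (Fin 3)) (hθ : ContDiff ℝ 1 θ)
    (x : EuclideanSpace ℝ (Fin 3)) : kernelIntegralOp (commKernelDir a) (gradient θ) x = 0 := by
  have e1 : kernelIntegralOp (commKernelDir a) (gradient θ) x =
      fderiv ℝ kwonCutoff x a • ∫ y, cross (gradient annularKernel (x - y)) (gradient θ y) := by
    rw [kernelIntegralOp, ← integral_smul]
    refine integral_congr_ae (Eventually.of_forall fun y => ?_)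
    simp only [commKernelDir, _root_.smul_apply, crossCLM_apply]
  rw [e1, integral_cross_gradient_gradient_eq_zero contDiff_annularKernel hasCompactSupport_annularKernel
    hθ x, smul_zero]

/-- **`T_{K_Δ} ∇θ = 0`**: the kernel operator of the `Δ`-commutator kills gradients
(`θ ∈ C¹_c`). [cite: Kwon2023RolePressure, (err.Deu)] -/
theorem kernelIntegralOp_commKernelLap_gradient (hθ : ContDiff ℝ 1 θ) (hθc : HasCompactSupport θ)
    (x : EuclideanSpace ℝ (Fin 3)) : kernelIntegralOp commKernelLap (gradient θ) x = 0 := by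
  have hgc : Continuous (gradient θ) := FluidPDE.continuous_gradient_of_contDiff hθ
  have hgs : HasCompactSupport (gradient θ) := by
    refine (hθc.fderiv (𝕜 := ℝ)).mono fun y hy => ?_
    rw [mem_support] at hy ⊢
    intro h0
    exact hy (by rw [gradient, h0, map_zero])
  set e : Fin 3 → EuclideanSpace ℝ (Fin 3) := fun i => EuclideanSpace.single i (1 : ℝ) with he
  have hint : ∀ g : EuclideanSpace ℝ (Fin 3) → EuclideanSpace ℝ (Fin 3), Continuous g →
      Integrable fun y => cross (g (x - y)) (gradient θ y) := fun g hg => by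
    have hc : Continuous fun y => cross (g (x - y)) (gradient θ y) :=
      continuous_cross_of (hg.comp (continuous_const.sub continuous_id)) hgc
    refine hc.integrable_of_hasCompactSupport (hgs.mono fun y hy h0 => hy ?_)
    show cross (g (x - y)) (gradient θ y) = 0
    rw [h0]; simp [cross]
  have hgk : Continuous (gradient annularKernel) :=
    (contDiff_gradient_of_contDiff (n := 0) (contDiff_annularKernel (n := 1))).continuous
  have hgki : ∀ i, Continuous (gradient (annularKernelDeriv (e i))) := fun i =>
    (contDiff_gradient_of_contDiff (n := 0) (contDiff_annularKernelDeriv _ (n := 1))).continuous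
  have hfun : (fun y => commKernelLap x y (gradient θ y)) = fun y =>
      ∑ i, (2 * fderiv ℝ kwonCutoff x (e i)) •
          cross (gradient (annularKernelDeriv (e i)) (x - y)) (gradient θ y)
        + ((Δ kwonCutoff) x) • cross (gradient annularKernel (x - y)) (gradient θ y) := by
    funext y
    simp only [commKernelLap, _root_.add_apply, FunLike.coe_sum, Finset.sum_apply,
      _root_.smul_apply, crossCLM_apply, he]
  have hi1 : ∀ i, Integrable fun y => (2 * fderiv ℝ kwonCutoff x (e i)) •
      cross (gradient (annularKernelDeriv (e i)) (x - y)) (gradient θ y) := fun i =>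
    (hint _ (hgki i)).smul (2 * fderiv ℝ kwonCutoff x (e i))
  have hi2 : Integrable fun y => ((Δ kwonCutoff) x) •
      cross (gradient annularKernel (x - y)) (gradient θ y) := (hint _ hgk).smul ((Δ kwonCutoff) x)
  rw [kernelIntegralOp, hfun, integral_add (integrable_finsetSum _ fun i _ => hi1 i) hi2,
    integral_finsetSum _ (fun i _ => hi1 i)]
  simp only [integral_smul]
  rw [integral_cross_gradient_gradient_eq_zero contDiff_annularKernel hasCompactSupport_annularKernel hθ x]
  simp only [smul_zero, add_zero]
  refine Finset.sum_eq_zero fun i _ => ?_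
  rw [integral_cross_gradient_gradient_eq_zero (contDiff_annularKernelDeriv _)
    (hasCompactSupport_annularKernelDeriv _) hθ x, smul_zero]

/-- **The transposed commutators annihilate gradients**: `∫ ⟪T'_K w, ∇θ⟫ = 0` for `w ∈ L¹`,
`θ ∈ C_c^∞` and `K = K_a`. [cite: Kwon2023RolePressure, Lemma 2.5 (proof, p. 8–9)] -/
theorem integral_inner_curlKernelTranspose_commKernelDir_gradient
    {w : EuclideanSpace ℝ (Fin 3) → EuclideanSpace ℝ (Fin 3)} (hw : Integrable w)
    (a : EuclideanSpace ℝ (Fin 3)) (hθ : ContDiff ℝ ∞ θ) (hθc : HasCompactSupport θ) :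
    ∫ y, ⟪curlKernelTranspose (commKernelDir a) w y, gradient θ y⟫ = 0 := by
  have hθ1 : ContDiff ℝ 1 θ := contDiff_infty.1 hθ 1
  have hgc : Continuous (gradient θ) := FluidPDE.continuous_gradient_of_contDiff hθ1
  have hgs : HasCompactSupport (gradient θ) := by
    refine (hθc.fderiv (𝕜 := ℝ)).mono fun y hy => ?_
    rw [mem_support] at hy ⊢
    intro h0
    exact hy (by rw [gradient, h0, map_zero])
  rw [← integral_inner_curl_kernelIntegralOp (contDiff_uncurry_commKernelDir a (n := 1))
    (hasCompactSupport_uncurry_commKernelDir a) hw hgc hgs]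
  have e : kernelIntegralOp (commKernelDir a) (gradient θ) = fun _ => 0 :=
    funext fun x => kernelIntegralOp_commKernelDir_gradient a hθ1 x
  rw [e]
  simp [curl_eq_curlCLM]

/-- **The transposed `Δ`-commutator annihilates gradients**: `∫ ⟪T'_{K_Δ} w, ∇θ⟫ = 0` for
`w ∈ L¹`, `θ ∈ C_c^∞`. [cite: Kwon2023RolePressure, (err.Deu)] -/
theorem integral_inner_curlKernelTranspose_commKernelLap_gradient
    {w : EuclideanSpace ℝ (Fin 3) → EuclideanSpace ℝ (Fin 3)} (hw : Integrable w)
    (hθ : ContDiff ℝ ∞ θ) (hθc : HasCompactSupport θ) :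
    ∫ y, ⟪curlKernelTranspose commKernelLap w y, gradient θ y⟫ = 0 := by
  have hθ1 : ContDiff ℝ 1 θ := contDiff_infty.1 hθ 1
  have hgc : Continuous (gradient θ) := FluidPDE.continuous_gradient_of_contDiff hθ1
  have hgs : HasCompactSupport (gradient θ) := by
    refine (hθc.fderiv (𝕜 := ℝ)).mono fun y hy => ?_
    rw [mem_support] at hy ⊢
    intro h0
    exact hy (by rw [gradient, h0, map_zero])
  rw [← integral_inner_curl_kernelIntegralOp (contDiff_uncurry_commKernelLap (n := 1))
    hasCompactSupport_uncurry_commKernelLap hw hgc hgs]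
  have e : kernelIntegralOp commKernelLap (gradient θ) = fun _ => 0 :=
    funext fun x => kernelIntegralOp_commKernelLap_gradient hθ1 hθc x
  rw [e]
  simp [curl_eq_curlCLM]

/-! ### Classically divergence-free pieces annihilate gradients -/

/-- `∫ ⟪G, ∇θ⟫ = 0` for a `C¹` field with `div G = 0` and `θ ∈ C¹_c` (integration by parts).
[folklore] -/
private theorem integral_inner_gradient_eq_zero_of_divFree
    {G : EuclideanSpace ℝ (Fin 3) → EuclideanSpace ℝ (Fin 3)} (hG : ContDiff ℝ 1 G)
    (hdiv : ∀ x, VectorCalculus.divergence G x = 0) (hθ : ContDiff ℝ 1 θ) (hθc : HasCompactSupport θ) :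
    ∫ x, ⟪G x, gradient θ x⟫ = 0 := by
  have h := integral_mul_divergence_add_eq_zero_left hθ hG hθc
  simp only [hdiv, mul_zero, integral_zero, zero_add] at h
  exact h

/-- **The harmonic-part curl forces annihilate gradients**: `∫ ⟪curl((∂ₐk) ⋆ j), ∇θ⟫ = 0` for an
integrable density `j` (`div curl = 0`). [cite: Kwon2023RolePressure, Lemma 2.5 (proof, p. 8)] -/
theorem integral_inner_curl_potentialDeriv_gradient
    {j : EuclideanSpace ℝ (Fin 3) → EuclideanSpace ℝ (Fin 3)} (hj : LocallyIntegrable j volume)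
    (a : EuclideanSpace ℝ (Fin 3)) (hθ : ContDiff ℝ 1 θ) (hθc : HasCompactSupport θ) :
    ∫ x, ⟪curl ((fun z => fderiv ℝ annularKernel z a) ⋆[lsmul ℝ ℝ, volume] j) x, gradient θ x⟫ = 0 := by
  have hG : ContDiff ℝ 2 ((fun z => fderiv ℝ annularKernel z a) ⋆[lsmul ℝ ℝ, volume] j) :=
    (hasCompactSupport_annularKernelDeriv a).contDiff_convolution_left _
      (contDiff_annularKernelDeriv a) hj
  refine integral_inner_gradient_eq_zero_of_divFree (contDiff_curl (n := 1) hG)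
    (fun x => divergence_curl_eq_zero_holds _ hG x) hθ hθc

/-- **The Leray projection of the self-stretching annihilates gradients**: `∫ ⟪P[F], ∇θ⟫ = 0`,
`F = φ♭ (h·∇)h` (`div P[F] = 0`). [cite: Kwon2023RolePressure, Lemma 2.5 (proof, p. 9)] -/
theorem integral_inner_classicalLerayProj_selfStretch_gradient
    (hU : IntegrableOn U (ball (0 : EuclideanSpace ℝ (Fin 3)) 2)) (hθ : ContDiff ℝ 1 θ)
    (hθc : HasCompactSupport θ) :
    ∫ x, ⟪classicalLerayProj (selfStretch U) x, gradient θ x⟫ = 0 := by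
  have hF : ContDiff ℝ ∞ (selfStretch U) := contDiff_selfStretch hU
  have hFc : HasCompactSupport (selfStretch U) := hasCompactSupport_selfStretch
  exact integral_inner_gradient_eq_zero_of_divFree
    (contDiff_infty.1 (contDiff_classicalLerayProj hF hFc) 1)
    (isDivFree_classicalLerayProj hF hFc) hθ hθc

/-! ### The slice force annihilates gradients -/

/-- **Kwon's slice force is weakly divergence free**: `∫ ⟪f_U, ∇θ⟫ = 0` for `U ∈ L¹ ∩ L²` and
every `θ ∈ C_c^∞(ℝ³)`. [cite: Kwon2023RolePressure, Lemma 2.5 (proof, p. 8–9)] -/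
theorem integral_inner_kwonSliceForce_gradient_eq_zero (hUm : AEStronglyMeasurable U volume)
    (hU1 : Integrable U) (hU2 : Integrable fun x => ‖U x‖ ^ 2) (hθ : ContDiff ℝ ∞ θ)
    (hθc : HasCompactSupport θ) :
    ∫ y, ⟪kwonSliceForce U y, gradient θ y⟫ = 0 := by
  have hθ1 : ContDiff ℝ 1 θ := contDiff_infty.1 hθ 1
  have hgc : Continuous (gradient θ) := FluidPDE.continuous_gradient_of_contDiff hθ1
  have hgs : HasCompactSupport (gradient θ) := by
    refine (hθc.fderiv (𝕜 := ℝ)).mono fun y hy => ?_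
    rw [mem_support] at hy ⊢
    intro h0
    exact hy (by rw [gradient, h0, map_zero])
  have hw : ∀ i : Fin 3, Integrable fun x => U x i • U x := integrable_coord_smul hUm hU2
  -- integrability of the four pieces against `∇θ`
  have if1 : Integrable fun y => ⟪curlKernelTranspose commKernelLap U y, gradient θ y⟫ :=
    ((continuous_curlKernelTranspose contDiff_uncurry_commKernelLap
      hasCompactSupport_uncurry_commKernelLap hU1).inner (𝕜 := ℝ) hgc)
      |>.integrable_of_hasCompactSupport (hgs.mono support_inner_subset_right)
  have if2 : ∀ i : Fin 3, Integrable fun y => ⟪curlKernelTranspose (commKernelDir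
      (EuclideanSpace.single i (1 : ℝ))) (fun x => U x i • U x) y, gradient θ y⟫ := fun i =>
    ((continuous_curlKernelTranspose (contDiff_uncurry_commKernelDir _)
      (hasCompactSupport_uncurry_commKernelDir _) (hw i)).inner (𝕜 := ℝ) hgc)
      |>.integrable_of_hasCompactSupport (hgs.mono support_inner_subset_right)
  have if3 : ∀ i : Fin 3, Integrable fun y => ⟪curl ((fun z => fderiv ℝ annularKernel z
      (EuclideanSpace.single i (1 : ℝ))) ⋆[lsmul ℝ ℝ, volume] vectorDensity (fun x => U x i • U x)) y,
        gradient θ y⟫ := fun i => by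
    refine (Continuous.inner (𝕜 := ℝ) ?_ hgc).integrable_of_hasCompactSupport
      (hgs.mono support_inner_subset_right)
    refine contDiff_curl (n := 0) ?_ |>.continuous
    exact (hasCompactSupport_annularKernel.fderiv_apply (𝕜 := ℝ) _).contDiff_convolution_left _
      (((contDiff_annularKernel (n := 2)).fderiv_right (m := 1) le_rfl).clm_apply contDiff_const)
      (integrable_vectorDensity (hw i).integrableOn).locallyIntegrable
  have if4 : Integrable fun y => ⟪classicalLerayProj (selfStretch U) y, gradient θ y⟫ :=
    ((contDiff_classicalLerayProj (contDiff_selfStretch hU1.integrableOn)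
      hasCompactSupport_selfStretch).continuous.inner (𝕜 := ℝ) hgc)
      |>.integrable_of_hasCompactSupport (hgs.mono support_inner_subset_right)
  -- the four vanishing facts
  have z1 := integral_inner_curlKernelTranspose_commKernelLap_gradient hU1 hθ hθc
  have z2 : ∀ i : Fin 3, ∫ y, ⟪curlKernelTranspose (commKernelDir
      (EuclideanSpace.single i (1 : ℝ))) (fun x => U x i • U x) y, gradient θ y⟫ = 0 := fun i =>
    integral_inner_curlKernelTranspose_commKernelDir_gradient (hw i) _ hθ hθc
  have z3 : ∀ i : Fin 3, ∫ y, ⟪curl ((fun z => fderiv ℝ annularKernel z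
      (EuclideanSpace.single i (1 : ℝ))) ⋆[lsmul ℝ ℝ, volume] vectorDensity (fun x => U x i • U x)) y,
        gradient θ y⟫ = 0 := fun i =>
    integral_inner_curl_potentialDeriv_gradient
      (integrable_vectorDensity (hw i).integrableOn).locallyIntegrable _ hθ1 hθc
  have z4 := integral_inner_classicalLerayProj_selfStretch_gradient hU1.integrableOn hθ1 hθc
  -- expand the force and split the integral
  have e : ∀ y, ⟪kwonSliceForce U y, gradient θ y⟫ =
      -⟪curlKernelTranspose commKernelLap U y, gradient θ y⟫
      - (∑ i, ⟪curlKernelTranspose (commKernelDir (EuclideanSpace.single (i : Fin 3) (1 : ℝ)))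
          (fun x => U x i • U x) y, gradient θ y⟫)
      - (∑ i, ⟪curl ((fun z => fderiv ℝ annularKernel z (EuclideanSpace.single (i : Fin 3) (1 : ℝ)))
          ⋆[lsmul ℝ ℝ, volume] vectorDensity (fun x => U x i • U x)) y, gradient θ y⟫)
      - ⟪classicalLerayProj (selfStretch U) y, gradient θ y⟫ := fun y => by
    simp only [kwonSliceForce, inner_sub_left, inner_neg_left, sum_inner]
  have ib : Integrable fun y => ∑ i, ⟪curlKernelTranspose (commKernelDir
      (EuclideanSpace.single (i : Fin 3) (1 : ℝ))) (fun x => U x i • U x) y, gradient θ y⟫ :=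
    integrable_finsetSum _ fun i _ => if2 i
  have ic : Integrable fun y => ∑ i, ⟪curl ((fun z => fderiv ℝ annularKernel z
      (EuclideanSpace.single (i : Fin 3) (1 : ℝ))) ⋆[lsmul ℝ ℝ, volume]
        vectorDensity (fun x => U x i • U x)) y, gradient θ y⟫ := integrable_finsetSum _ fun i _ => if3 i
  have ineg : Integrable fun y => -⟪curlKernelTranspose commKernelLap U y, gradient θ y⟫ := if1.neg
  have i1 : Integrable fun y => -⟪curlKernelTranspose commKernelLap U y, gradient θ y⟫
      - ∑ i, ⟪curlKernelTranspose (commKernelDir (EuclideanSpace.single (i : Fin 3) (1 : ℝ)))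
          (fun x => U x i • U x) y, gradient θ y⟫ := ineg.sub ib
  have i2 : Integrable fun y => -⟪curlKernelTranspose commKernelLap U y, gradient θ y⟫
      - (∑ i, ⟪curlKernelTranspose (commKernelDir (EuclideanSpace.single (i : Fin 3) (1 : ℝ)))
          (fun x => U x i • U x) y, gradient θ y⟫)
      - ∑ i, ⟪curl ((fun z => fderiv ℝ annularKernel z (EuclideanSpace.single (i : Fin 3) (1 : ℝ)))
          ⋆[lsmul ℝ ℝ, volume] vectorDensity (fun x => U x i • U x)) y, gradient θ y⟫ := i1.sub ic
  simp_rw [e]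
  rw [integral_sub i2 if4, integral_sub i1 ic, integral_sub ineg ib, integral_neg,
    integral_finsetSum _ (fun i _ => if2 i), integral_finsetSum _ (fun i _ => if3 i), z1, z4]
  simp only [z2, z3, Finset.sum_const_zero, neg_zero, sub_zero]

/-! ### The `force_divFree` clause -/

variable {W f : ℝ → EuclideanSpace ℝ (Fin 3) → EuclideanSpace ℝ (Fin 3)}
  {O : Opens (ℝ × EuclideanSpace ℝ (Fin 3))}

/-- **The `force_divFree` clause of Def. 2.4 for Kwon's force** `f(t) = f_{W(t)}`
(`forceField`), on every open space–time region on which `f` is locally integrable (the class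
`f ∈ L¹_t L²_x(O)` of Def. 2.4, Kwon's (est.f), implies it): `∫∫_O ⟪f, ∇θ⟫ = 0` for
`θ ∈ C_c^∞(O)` — slice by slice (`integral_inner_kwonSliceForce_gradient_eq_zero`) and Fubini.
[cite: Kwon2023RolePressure, Lemma 2.5 with Def. 2.4] -/
theorem divFree_forceField (hW : IsGoodVelocity W) (hf : ∀ t x, f t x = forceField W t x)
    (hfi : LocallyIntegrableOn (uncurry f) (O : Set (ℝ × EuclideanSpace ℝ (Fin 3))) volume) :
    ∀ θ : ℝ → EuclideanSpace ℝ (Fin 3) → ℝ, IsSpaceTimeTestOn O θ →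
      ∫ z in (O : Set (ℝ × EuclideanSpace ℝ (Fin 3))), ⟪f z.1 z.2, gradient (θ z.1) z.2⟫ = 0 := by
  intro θ hθ
  obtain ⟨cg, -, zg⟩ := hθ.continuous_gradient_field
  have I : Integrable (fun z : ℝ × EuclideanSpace ℝ (Fin 3) => ⟪f z.1 z.2, gradient (θ z.1) z.2⟫) :=
    integrable_inner_of_locallyIntegrableOn hfi cg hθ.hasCompactSupport hθ.tsupport_subset zg
  have hzero : ∀ z : ℝ × EuclideanSpace ℝ (Fin 3), z ∉ (O : Set (ℝ × EuclideanSpace ℝ (Fin 3))) →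
      ⟪f z.1 z.2, gradient (θ z.1) z.2⟫ = 0 := fun z hz => by
    rw [zg z fun h' => hz (hθ.tsupport_subset h'), inner_zero_right]
  rw [setIntegral_eq_integral_of_forall_compl_eq_zero hzero, Measure.volume_eq_prod,
    integral_prod _ I]
  refine integral_eq_zero_of_ae (Eventually.of_forall fun t => ?_)
  have eft : f t = kwonSliceForce (W t) := funext fun x => by rw [hf]; rfl
  show ∫ x, ⟪f t x, gradient (θ t) x⟫ = 0
  rw [eft]
  exact integral_inner_kwonSliceForce_gradient_eq_zero (hW.aestronglyMeasurable_slice t)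
    (hW.integrable t) (hW.integrable_sq t) (hθ.contDiff_slice t) (hθ.hasCompactSupport_slice t)

end Kwon2023

end Literature.Analysis.FluidPDE

end
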